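import Literature.Probability.Percolation.ZdDualFrame
import HarnessLib

/-!
# Separation of the tips of an open object and a closed-dual object of the side rectangle

Topic `Literature/Probability/Percolation`; bond percolation on `ℤ² = Site 2`.  PROOFS ONLY (no
definition, no named fact).  The deterministic heart of the EXTERNAL per-scale lemma of Kesten's
arm-separation theorem for four alternating arms of bond percolation on `ℤ²`, cluster–frontier
form (H. Kesten, CMP 109 (1987), §2, Lemma 4; P. Nolin, EJP 13 (2008), §4.4, proof of Lemma 15
[arXiv 0711.4948: Lemma 14, p. 11]: the protecting circuits "prevent other disjoint black
crossings to arrive near `z_u`", so that "the `T` crossings considered arrive at `η'`-separated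
points").  In the rectangle `R = [0,M] × [0,N]` consider a realised open frontier `S`
(`ω ∈ frontierEvent M N S`, tip `z = (M, t)`, `t = (tipOf M N S) 1`) and a realised closed-dual
frontier `S♭` of the faces inside `R`, read in the dual frame
(`dualConfig ω ∈ frontierEvent (M-1) (N-1) S♭`, `ZdDualFrame.lean`; dual tip face `(M-1, t♭)` of the
right face column).  If the open object carries an open protection ring at scale `ρ` read on its
fresh pairs (`ω ∈ openedOn B_S (openRing M t ρ)`) and the dual object a closed-dual protection ring
at scale `ρ♭` (`dualConfig ω ∈ openedOn B♭ (openRing (M-1) t♭ ρ♭)`), then the two tips are far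
apart on the right side: `|t - t♭| ≳ min(ρ, ρ♭)` (`tip_separation`).

The proof is Jordan-free.  DICHOTOMY (`faces_all_or_none`): the faces of `S♭` are all flooded
for `↑S` (in `belowFaces M N S`) or none is, because consecutive faces of `S♭` are separated by
an `ω`-closed edge, which is not in `S ⊆ ω`, so the flood of `↑S` propagates along `S♭`.
* NONE: the steps of `S♭` cross edges that are `ω`-closed and not below pairs of `S` (an edge
  bounds exactly its two faces, `eq_or_eq_of_sepEdge_mem_squareEdges`), i.e. closed in
  `ω ∪ B_S`; the open ring of the open object then keeps `S♭` — a face walk from the dual tip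
  face to the left face column — out of the square of radius `ρ` around `z`
  (`openRing_blocks_faceWalk`).
* ALL: the dual tip face `(M-1, t♭)` is flooded for `↑S`, so `t♭ < t` (faces of the right face
  column at rows `≥ t` are above, `LowPath.isAboveFace_rightCol`); in the dual frame the primal
  site `(M-1, t)` is the face `(M-2, t-1)` of the right column of the dual rectangle of the faces,
  at a row `≥ t♭`, hence NOT flooded for `↑S♭`; the dual flood propagates along the last excursion
  `S'` of `S` from the left side (its inner sites, shifted by `-(1,1)`, are faces of that dual
  rectangle joined across `dualConfig ω`-closed edges, not in `S♭ ⊆ dualConfig ω`), so no site of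
  `S'` is flooded for `↑S♭`, the shifted steps of `S'` avoid `B♭`, and the ring of the dual object
  keeps `S'` — a walk of shifted sites from `(M-1, t-1)` to the column `-1` — out of the square of
  radius `ρ♭` around the dual tip.

## References

* P. Nolin, *Near-critical percolation in two dimensions*, EJP 13 (2008), §4.4, proof of
  Lemma 15 (arXiv 0711.4948: Lemma 14, p. 11) [Nolin2008].
* H. Kesten, *Scaling relations for 2D-percolation*, CMP 109 (1987), §2, Lemma 4 [KestenScalingCMP1987].
* G. Grimmett, *Percolation*, 2nd ed. (1999), §11.2 [Grimmett1999].
-/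

noncomputable section

open SimpleGraph Finset

namespace Literature.Probability.Percolation

open LatticeModels

variable {M N : ℕ} {ω : BondConfig (Site 2)} {S T : Finset (Sym2 (Site 2))}

/-! ### An edge bounds exactly its two faces -/

/-- The faces bounded by the edge separating two adjacent faces are these two faces. [folklore] -/
theorem eq_or_eq_of_sepEdge_mem_squareEdges {g g' f : Site 2} (h : (zdGraph 2).Adj g g')
    (hf : sepEdge g g' ∈ squareEdges f) : f = g ∨ f = g' := by
  have := mem_dualEdge_of_mem_squareEdges hf
  rw [dualEdge_sepEdge h, Sym2.mem_iff] at this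
  exact this

/-- **An edge both of whose faces are unflooded is not a below pair.** [folklore] -/
theorem sepEdge_not_mem_belowPairs {g g' : Site 2} (h : (zdGraph 2).Adj g g') (hg : g ∉ belowFaces M N S)
    (hg' : g' ∉ belowFaces M N S) : sepEdge g g' ∉ belowPairs M N S := by
  intro he
  obtain ⟨f, hf, hfe⟩ := mem_belowPairs_iff.1 he
  rcases eq_or_eq_of_sepEdge_mem_squareEdges h hfe with rfl | rfl
  · exact hg hf
  · exact hg' hf

/-! ### The flood propagates along walks whose steps do not cross `S` -/

/-- **Flood propagation**: along a walk of faces of `R*` whose steps cross edges not in `S`, either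
every face is flooded for `↑S` or none is. [folklore] -/
theorem mem_belowFaces_iff_of_walk {f g : Site 2} (W : (zdGraph 2).Walk f g)
    (hWR : ∀ z ∈ W.support, z ∈ dualRectangle M N) (hWS : ∀ d ∈ W.darts, sepEdge d.fst d.snd ∉ S) :
    ∀ z ∈ W.support, (z ∈ belowFaces M N S ↔ f ∈ belowFaces M N S) := by
  induction W with
  | nil => intro z hz; rw [Walk.support_nil, List.mem_singleton] at hz; rw [hz]
  | @cons u v w huv W ih =>
    have hvR : v ∈ dualRectangle M N := hWR v (by simp)
    have huR : u ∈ dualRectangle M N := hWR u (by simp)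
    have hstep : sepEdge u v ∉ S := hWS ⟨(u, v), huv⟩ (by simp)
    have hduv : s(u, v) ∈ dualConfig (↑S : BondConfig (Site 2)) :=
      (mk_mem_dualConfig_iff_sepEdge_notMem huv).2 (by exact_mod_cast hstep)
    have hdvu : s(v, u) ∈ dualConfig (↑S : BondConfig (Site 2)) := by rw [Sym2.eq_swap]; exact hduv
    have huv_iff : (v ∈ belowFaces M N S ↔ u ∈ belowFaces M N S) :=
      ⟨fun h => mem_dualBelowR_of_adj h huR hdvu, fun h => mem_dualBelowR_of_adj h hvR hduv⟩
    intro z hz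
    rw [Walk.support_cons, List.mem_cons] at hz
    rcases hz with rfl | hz
    · exact Iff.rfl
    · rw [ih (fun x hx => hWR x (by simp [hx])) (fun d hd => hWS d (by simp [hd])) z hz, huv_iff]

/-! ### The objects -/

section Objects

/-- **Dichotomy**: the faces of a realised closed-dual frontier `T` (of the faces inside `R`) are
all flooded for `↑S`, or none is (`S ⊆ ω`, `T ⊆ dualConfig ω`, `M, N ≥ 2`). [cite: Nolin2008, §4.4, proof of Lemma 15 (arXiv 0711.4948: Lemma 14, p. 11)] -/
theorem faces_all_or_none (hM : 2 ≤ M) (hN : 2 ≤ N) (hSω : (↑S : Set (Sym2 (Site 2))) ⊆ ω)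
    (hT : IsFrontierSet (M - 1) (N - 1) T) (hTω : (↑T : Set (Sym2 (Site 2))) ⊆ dualConfig ω) :
    (∀ a ∈ edgeVerts (↑T : Set (Sym2 (Site 2))), a ∈ belowFaces M N S) ∨
      ∀ a ∈ edgeVerts (↑T : Set (Sym2 (Site 2))), a ∉ belowFaces M N S := by
  classical
  have hM1 : 1 ≤ M - 1 := by omega
  by_cases h : ∃ a ∈ edgeVerts (↑T : Set (Sym2 (Site 2))), a ∈ belowFaces M N S
  · obtain ⟨a₀, ha₀, ha₀b⟩ := h
    refine Or.inl fun a ha => ?_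
    obtain ⟨W, hWR, hWe⟩ := hT.exists_walk_of_mem_edgeVerts hM1 ha₀ ha
    have hWR' : ∀ z ∈ W.support, z ∈ dualRectangle M N := fun z hz =>
      rectangle_pred_subset_dualRectangle (by omega) (by omega) (hWR z hz)
    have hWd : ∀ d ∈ W.darts, sepEdge d.fst d.snd ∉ ω :=
      (forall_edges_mem_dualConfig_iff W).1 fun e he => hTω (Finset.mem_coe.2 (hWe e he))
    have hWS : ∀ d ∈ W.darts, sepEdge d.fst d.snd ∉ S := fun d hd hdS => hWd d hd (hSω (Finset.mem_coe.2 hdS))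
    exact (mem_belowFaces_iff_of_walk W hWR' hWS _ W.end_mem_support).2 ha₀b
  · push Not at h
    exact Or.inr h

end Objects

/-! ### Induction along the darts of a walk -/

/-- A property holding at the start of a walk and preserved along its darts holds on its support.
[folklore] -/
theorem forall_support_of_darts {V : Type*} {G : SimpleGraph V} (Q : V → Prop) :
    ∀ {a b : V} (W : G.Walk a b), Q a → (∀ d ∈ W.darts, Q d.fst → Q d.snd) → ∀ v ∈ W.support, Q v
  | _, _, Walk.nil, ha, _ => by intro v hv; rw [Walk.support_nil, List.mem_singleton] at hv; rwa [hv]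
  | a, _, Walk.cons (v := u) h W, ha, hstep => by
    have hu : Q u := hstep ⟨(a, u), h⟩ (by simp) ha
    intro v hv
    rw [Walk.support_cons, List.mem_cons] at hv
    rcases hv with rfl | hv
    · exact ha
    · exact forall_support_of_darts Q W hu (fun d hd => hstep d (by simp [hd])) v hv

/-! ### The separation theorem -/

/-- **Tips of an open object and of a closed-dual object carrying protection rings are far apart.**
`R = [0,M] × [0,N]`, `M, N ≥ 2`, `ω` a lattice configuration; `S` a realised open frontier with an
open ring at scale `ρ` read on its fresh pairs, `T` a realised closed-dual frontier of the faces
inside `R` (dual frame) with a ring at scale `ρ'` read on its fresh pairs, `2ρ + 1 ≤ M`,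
`2ρ' + 1 ≤ M`.  Then with `t = (tipOf M N S) 1` and `t' = (tipOf (M-1) (N-1) T) 1` (the row of the
dual tip face): `t' + ρ ≤ t ∨ t + ρ ≤ t'` or `t + ρ' ≤ t' ∨ t' + ρ' + 1 ≤ t`. [cite: Nolin2008, §4.4, proof of Lemma 15 (arXiv 0711.4948: Lemma 14, p. 11)] -/
theorem tip_separation (hM : 2 ≤ M) (hN : 2 ≤ N) (hωE : ω ⊆ (zdGraph 2).edgeSet)
    (hS : IsFrontierSet M N S) (hω : ω ∈ frontierEvent M N S)
    (hT : IsFrontierSet (M - 1) (N - 1) T) (hωT : dualConfig ω ∈ frontierEvent (M - 1) (N - 1) T)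
    {ρ ρ' : ℕ} (hρ : 1 ≤ ρ) (hρM : 2 * ρ + 1 ≤ M) (hρ' : 1 ≤ ρ') (hρ'M : 2 * ρ' + 1 ≤ M)
    (hringS : ω ∈ openedOn (belowPairs M N S) (openRing M ((tipOf M N S) 1) ρ))
    (hringT : dualConfig ω ∈ openedOn (belowPairs (M - 1) (N - 1) T) (openRing (M - 1) ((tipOf (M - 1) (N - 1) T) 1) ρ')) :
    ((tipOf (M - 1) (N - 1) T) 1 + ρ ≤ (tipOf M N S) 1 ∨ (tipOf M N S) 1 + ρ ≤ (tipOf (M - 1) (N - 1) T) 1) ∨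
      ((tipOf M N S) 1 + ρ' ≤ (tipOf (M - 1) (N - 1) T) 1 ∨ (tipOf (M - 1) (N - 1) T) 1 + ρ' + 1 ≤ (tipOf M N S) 1) := by
  classical
  have hM1 : 1 ≤ M := by omega
  have hM1' : 1 ≤ M - 1 := by omega
  have hcast : ((M - 1 : ℕ) : ℤ) = M - 1 := by push_cast [Nat.cast_sub hM1]; ring
  have hcastN : ((N - 1 : ℕ) : ℤ) = N - 1 := by push_cast [Nat.cast_sub (show 1 ≤ N by omega)]; ring
  have hSω : (↑S : Set (Sym2 (Site 2))) ⊆ ω := hω.1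
  have hTω : (↑T : Set (Sym2 (Site 2))) ⊆ dualConfig ω := hωT.1
  -- the two lowest crossings and their tips
  obtain ⟨Λ⟩ := nonempty_lowPath (ω := (↑S : BondConfig (Site 2))) hM1 hS.2
  obtain ⟨Γ⟩ := nonempty_lowPath (ω := (↑T : BondConfig (Site 2))) hM1' hT.2
  have hΛb : Λ.b = tipOf M N S := Λ.b_eq_tipOf_coe hM1 hS.2
  have hΓb : Γ.b = tipOf (M - 1) (N - 1) T := Γ.b_eq_tipOf_coe hM1' hT.2
  rw [← hΛb] at hringS ⊢
  rw [← hΓb] at hringT ⊢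
  have hΛb0 : Λ.b 0 = M := Λ.right
  have hΓb0 : Γ.b 0 = (M : ℤ) - 1 := by rw [Γ.right, hcast]
  have hΓa0 : Γ.a 0 = 0 := Γ.left
  have hbR := mem_rectangle_iff.1 Λ.b_mem_rectangle
  have hbR' := mem_rectangle_iff.1 Γ.b_mem_rectangle
  simp only [hcast, hcastN] at hbR'
  by_contra hcon
  simp only [not_or, not_le] at hcon
  obtain ⟨⟨h1, h2⟩, h3, h4⟩ := hcon
  rcases faces_all_or_none hM hN hSω hT hTω with hall | hnone
  · /- ALL: the dual tip face is flooded for `↑S`, so `t' < t`; the dual flood then misses every site of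
      the last excursion of `S`, whose shifted steps avoid `B♭`, and the ring of `T` blocks it. -/
    have hΓbv : Γ.b ∈ edgeVerts (↑T : Set (Sym2 (Site 2))) :=
      (hT.mem_edgeVerts_iff_mem_support hM1' Γ).2 Γ.path.end_mem_support
    have hflood := hall _ hΓbv
    -- `t' < t`
    have htt' : Γ.b 1 < Λ.b 1 := by
      by_contra hlt
      rw [not_lt] at hlt
      have habove := Λ.isAboveFace_rightCol hM1 hS.2 (y := Γ.b 1) hlt (by omega)
      have heq : (![(M : ℤ) - 1, Γ.b 1] : Site 2) = Γ.b := by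
        rw [Site.eq_iff_two]
        exact ⟨by rw [Matrix.cons_val_zero, hΓb0], by simp⟩
      rw [heq] at habove
      exact habove.mem_offBelow.2 hflood
    -- the face `(M-2, t-1)` of the site `(M-1, t)` is not flooded for `↑T`
    have hΓabove : ∀ v : Site 2, v 0 = (M : ℤ) - 1 → v 1 = Λ.b 1 → v - 1 ∉ belowFaces (M - 1) (N - 1) T := by
      intro v hv0 hv1 hvb
      have habove := Γ.isAboveFace_rightCol hM1' hT.2 (y := Λ.b 1 - 1) (by omega) (by rw [hcastN]; omega)
      have heq : (![((M - 1 : ℕ) : ℤ) - 1, Λ.b 1 - 1] : Site 2) = v - 1 := by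
        rw [Site.eq_iff_two]
        exact ⟨by rw [Matrix.cons_val_zero, Pi.sub_apply, Pi.one_apply, hv0, hcast], by
          rw [Pi.sub_apply, Pi.one_apply, hv1]; simp⟩
      rw [heq] at habove
      exact habove.mem_offBelow.2 hvb
    -- the last excursion of `S` from the left side: reverse `Λ.path`, stop at the first vertex of column `0`
    set A : Set (Site 2) := {v | 1 ≤ v 0} with hA
    obtain ⟨x, y, δ₁, hxy, hy, hδ₁A, hδ₁S, hδ₁E, hlast⟩ :=
      exists_prefix_exit (A := A) Λ.path.reverse (by simp only [hA, Set.mem_setOf_eq]; omega)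
        (by simp only [hA, Set.mem_setOf_eq, Λ.left]; omega)
    simp only [hA, Set.mem_setOf_eq, not_le] at hy hδ₁A
    have hyΛ : y ∈ Λ.path.support := by
      have := Λ.path.reverse.snd_mem_support_of_mem_edges hlast; rwa [Walk.support_reverse, List.mem_reverse] at this
    have hy0 : y 0 = 0 := by have := (mem_rectangle_iff.1 (Λ.mem_rectangle y hyΛ)).1; omega
    set π := δ₁.concat hxy with hπ
    have hπE : ∀ e ∈ π.edges, e ∈ S := by
      intro e he
      rw [hπ, Walk.edges_concat, List.concat_eq_append, List.mem_append, List.mem_singleton] at he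
      rcases he with he | rfl
      · exact (hS.mem_edges_iff Λ).1 (by have := hδ₁E e he; rwa [Walk.edges_reverse, List.mem_reverse] at this)
      · exact (hS.mem_edges_iff Λ).1 (by rwa [Walk.edges_reverse, List.mem_reverse] at hlast)
    have hπS : ∀ v ∈ π.support, v ∈ Λ.path.support := by
      intro v hv
      rw [hπ, Walk.support_concat, List.mem_append, List.mem_singleton] at hv
      rcases hv with hv | rfl
      · have := hδ₁S v hv; rwa [Walk.support_reverse, List.mem_reverse] at this
      · exact hyΛ
    have hπfst : ∀ d ∈ π.darts, 1 ≤ d.fst 0 := by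
      intro d hd
      rw [hπ, Walk.darts_concat, List.concat_eq_append, List.mem_append, List.mem_singleton] at hd
      rcases hd with hd | rfl
      · exact hδ₁A _ (δ₁.dart_fst_mem_support_of_mem_darts hd)
      · exact hδ₁A x δ₁.end_mem_support
    -- no site of `π`, shifted by `-(1,1)`, is a face flooded for `↑T`
    have hQ : ∀ v ∈ π.support, v - 1 ∉ belowFaces (M - 1) (N - 1) T := by
      refine forall_support_of_darts (fun v : Site 2 => v - 1 ∉ belowFaces (M - 1) (N - 1) T) π ?_ ?_
      · -- the tip: its shifted site has column `M - 1`, outside the dual rectangle of the faces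
        intro hb
        have := (mem_dualRectangle_pred_iff hM1 (show 1 ≤ N by omega)).1 (belowFaces_subset hb)
        rw [sub_add_cancel] at this
        omega
      · intro d hd hfst hsnd
        have hdS : s(d.fst, d.snd) ∈ S := hπE _ (by rw [Walk.edges]; exact List.mem_map.2 ⟨d, hd, rfl⟩)
        have hsndR := (mem_dualRectangle_pred_iff hM1 (show 1 ≤ N by omega)).1 (belowFaces_subset hsnd)
        rw [sub_add_cancel] at hsndR
        have hfstR := mem_rectangle_iff.1 (Λ.mem_rectangle _ (hπS _ (π.dart_fst_mem_support_of_mem_darts hd)))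
        have h1fst := hπfst d hd
        by_cases hfM : d.fst 0 = M
        · -- the edge of `S` at the tip is horizontal: `d.snd = d.fst - e₀ = (M-1, t)`
          have hfst_eq : d.fst = Λ.b := by
            by_contra hne
            have := Λ.apply_zero_lt_of_ne hM1 (hπS _ (π.dart_fst_mem_support_of_mem_darts hd)) hne
            omega
          have hlow : IsLowEdge M N (↑S : BondConfig (Site 2)) s(d.fst, d.snd) := (hS.1 _).2 hdS
          have heq := hlow.eq_of_mem_of_apply_zero_eq (Sym2.mem_mk_left _ _) hfM
          have hsnd_eq : d.snd = d.fst - Pi.single 0 1 := by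
            rcases Sym2.eq_iff.1 heq with ⟨h1', _⟩ | ⟨_, h2'⟩
            · exfalso
              have := congrFun h1' 0
              simp only [Pi.sub_apply, single_zero_apply_zero] at this
              omega
            · exact h2'
          refine hΓabove d.snd ?_ ?_ hsnd
          · rw [hsnd_eq, Pi.sub_apply, single_zero_apply_zero, hfM]
          · rw [hsnd_eq, Pi.sub_apply, single_zero_apply_one, hfst_eq]; ring
        · -- an inner step: the dual flood would propagate back to `d.fst`
          have hfstD : d.fst - 1 ∈ dualRectangle (M - 1) (N - 1) := by
            rw [mem_dualRectangle_pred_iff hM1 (show 1 ≤ N by omega), sub_add_cancel]; omega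
          refine hfst (mem_dualBelowR_of_adj hsnd hfstD ((mk_mem_dualConfig_iff_sepEdge_notMem (adj_sub_one d.adj.symm)).2 ?_))
          intro hmem
          have hdual : sepEdge (d.snd - 1) (d.fst - 1) ∈ dualConfig ω := hTω hmem
          rw [sepEdge_sub_one_mem_dualConfig_iff d.adj.symm] at hdual
          exact hdual (by rw [Sym2.eq_swap]; exact hSω (Finset.mem_coe.2 hdS))
    -- the shifted walk of `π`: its steps are closed in `dualConfig ω ∪ B♭`
    obtain ⟨δ, hδs, hδd⟩ := dualFaceWalk_of_walk π fun e he => hSω (Finset.mem_coe.2 (hπE e he))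
    have hδd' : ∀ d ∈ δ.darts, sepEdge d.fst d.snd ∉ dualConfig ω ∪ ↑(belowPairs (M - 1) (N - 1) T) := by
      intro d hd hmem
      rcases hmem with hmem | hmem
      · exact hδd d hd hmem
      · refine sepEdge_not_mem_belowPairs d.adj ?_ ?_ (Finset.mem_coe.1 hmem)
        · have := hQ _ (hδs _ (δ.dart_fst_mem_support_of_mem_darts hd)); rwa [add_sub_cancel_right] at this
        · have := hQ _ (hδs _ (δ.dart_snd_mem_support_of_mem_darts hd)); rwa [add_sub_cancel_right] at this
    have hE' : dualConfig ω ∪ ↑(belowPairs (M - 1) (N - 1) T) ⊆ (zdGraph 2).edgeSet :=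
      Set.union_subset (fun _ h => h.1) belowPairs_subset_edgeSet
    refine openRing_blocks_faceWalk (M := M - 1) hE' hρ' hringT δ hδd' ?_ ?_
    · simp only [Pi.sub_apply, Pi.one_apply, hΛb0, hcast]; omega
    · simp only [Pi.sub_apply, Pi.one_apply, hy0, hcast]; omega
  · /- NONE: the steps of `S♭` cross edges closed in `ω ∪ B_S`, and the open ring of `S` blocks the face
      walk of `S♭` from the dual tip face to the left face column. -/
    have hW'd : ∀ d ∈ Γ.path.darts, sepEdge d.fst d.snd ∉ ω :=
      (forall_edges_mem_dualConfig_iff Γ.path).1 fun e he => hTω (Finset.mem_coe.2 ((hT.mem_edges_iff Γ).1 he))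
    have hW'd' : ∀ d ∈ Γ.path.darts, sepEdge d.fst d.snd ∉ ω ∪ ↑(belowPairs M N S) := by
      intro d hd hmem
      rcases hmem with hmem | hmem
      · exact hW'd d hd hmem
      · refine sepEdge_not_mem_belowPairs d.adj ?_ ?_ (Finset.mem_coe.1 hmem)
        · exact hnone _ ((hT.mem_edgeVerts_iff_mem_support hM1' Γ).2 (Γ.path.dart_fst_mem_support_of_mem_darts hd))
        · exact hnone _ ((hT.mem_edgeVerts_iff_mem_support hM1' Γ).2 (Γ.path.dart_snd_mem_support_of_mem_darts hd))
    have hrev : ∀ d ∈ Γ.path.reverse.darts, sepEdge d.fst d.snd ∉ ω ∪ ↑(belowPairs M N S) := fun d hd =>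
      sepEdge_not_mem_of_mk_mem_edges hW'd' (by
        have : s(d.fst, d.snd) ∈ Γ.path.reverse.edges := by rw [Walk.edges]; exact List.mem_map.2 ⟨d, hd, rfl⟩
        rwa [Walk.edges_reverse, List.mem_reverse] at this)
    have hE' : ω ∪ ↑(belowPairs M N S) ⊆ (zdGraph 2).edgeSet := Set.union_subset hωE belowPairs_subset_edgeSet
    refine openRing_blocks_faceWalk (M := M) hE' hρ hringS Γ.path.reverse hrev ?_ ?_
    · rw [hΓb0]; omega
    · rw [hΓa0]; omega

end Literature.Probability.Percolation

end
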